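import Literature.MathematicalPhysics.QuantumFieldTheory.Balaban1983to89.B9Eq321LandauOrthogonalZd
import Literature.MathematicalPhysics.QuantumFieldTheory.Balaban1983to89.B9SupplySockB9P3ZdAt

/-!
# `Balaban1983to89.B9Eq321LandauProjectionZd` — [Balaban1985BackgroundPropagators] (3.20)–(3.22) p. 394: THE GAUGE-FIXING PROJECTION `R(U₀)` AS AN
# OBJECT on the `ℤᵈ × 𝔸` carriers — the orthogonal projection in the real Hilbert space `L²(Ω₀, 𝔤)` (`Ω₀` finite, pairing `Re τ(a*b)` of a faithful
# Hermitian trace `τ`) onto `Δ^η_{U₀}N(Q′(U₀))` —, the GENUINE LETTER `D R(U₀) D*` built from it, and the junction binder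
# `B9SupplySockB9P3ZdAt.LandauAt` ([Balaban1985RegularSpaces] (1.42) «the Landau condition kills the `DRD*` term») PROVED for that letter at EVERY
# unitary background and every member with finite `Ω₀` — no small-field hypothesis, no unitarity of the averaged backgrounds

statement-level skeleton of published theorems with citation tags; proofs where landed; nothing here is a claim about the
Yang–Mills mass gap

`[Balaban1985BackgroundPropagators]` ("B9", CMP **99** (1985) 389–434) p. 394: *«R = R(U) is an orthogonal projection in the Hilbert space L²(Ω₀, g)
onto the subspace R = Δ^η_U N(Q′), N(Q′) = {λ : Q′λ = 0}. (3.21) For an arbitrary function f ∈ L²(Ω₀, g) we have Rf = Δ^η_U λ₀, where λ₀ is a minimum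
of the function λ ∈ N(Q′), λ → ‖f − Δ^η_U λ‖². (3.22)»*, p. 395 *«Δ^η_a(U) = Δ^η(U) + D^η_U R(U) D^{η*}_U + Q*(U)aQ(U), (3.26)»*, p. 391 *«X·Y = tr XY»*;
`[Balaban1985RegularSpaces]` ("B8") (1.38) p. 82 *«R(U₀)D^{η*}_{U₀}A = 0»*, (1.42) p. 83, (1.58) p. 86 (the equation for `A` without the `DRD*` term).
PDF held: `paper:balaban1985-cmp99-background-propagators` pp. 392–395 (re-read by this seat, 2026-08-27).

CITATION HEADER (lean-in-tree rule).  Cell `pub-ymgap` (YM Track A, HUMAN RULING D-0062 ∕ D-0149 width push), DAG node N06 = [B9], width seat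
`pub-ymgap-dag-n06-w4` (g0), plan g77 `W-SEAT-START-LIST` § n06 ITEM 4 «(γ) Thm 3.3 at a curved U₀ at the carrier: the letters G(U₀), Δ′(U₀), R(U₀), Q*ⱼ
AS OPERATORS + the six binders PROVED — start with ONE binder (`LandauKills`)».  The junction's operator layer is a PARAMETER RECORD
`B9SupplySockB9P3ZdLetters.OpsZd` (`Gop ∕ Dp ∕ DRDs ∕ QQ` — «LETTERS, NOT OBJECTS»); its member-local binder `B9SupplySockB9P3ZdAt.LandauAt bg L mem ιCfg
ops c35 a₃ M i m` asks that `(ops M i m).DRDs U₀ A = 0` for every unitary `U₀` in the member's class (3.35) and every `A ∈ E(Ω₀)` obeying the Landau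
condition OF RECORD `B8Eq138LandauZd.IsLandau138` (multiplier form).  THIS FILE supplies the FIRST GENUINE LETTER of that record at curved backgrounds:
`R(U₀)` is CONSTRUCTED as print's orthogonal projection ((3.21)–(3.22)) — on the finite-dimensional real inner-product space of `𝔸`-valued functions
supported in the finite `Ω₀` with the pairing `Σ_x Re τ(f(x)* g(x))` (print's `Σ η^d tr λ(x)λ′(x)` on `𝔤`-valued functions, the positive weight `η^d`
dropped), onto the real subspace spanned by `{𝟙_{Ω₀}Δ^η_{U₀}λ : λ Hermitian-valued, supported in Ω₀, Q′_j(U₀)λ = 0 on Λ_j (j ≤ m)}` = `Δ^η_{U₀}N(Q′(U₀))`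
with Dirichlet conditions on `Ω₀` — and the letter `DRDs U₀ A := D^η_{U₀} R(U₀) (𝟙_{Ω₀}D^{η*}_{U₀}A)`; and it PROVES `LandauAt` for the letter family
`opsLandau τ ops₀` (any `ops₀`, its `DRDs` field replaced) at every member `(M, i, m)` with `(i.Ω 0).Finite`, from the companion file's orthogonality
theorem `B9Eq321LandauOrthogonalZd.finsum_trace_covLap_mul_covDivB_eq_zero_of_isLandau138` (tracial pairing, ALL backgrounds of units) and the
self-adjointness of `Δ^η_{U₀}λ` for unitary `U₀` and Hermitian `λ`.

WHAT IS DECLARED ∕ PROVED (kernel, 0 sorry; definitions with bodies + theorems; no `instance`, no `notation`).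
* §1 `suppSub s` (the real subspace of functions `ℤᵈ → 𝔸` supported in the finite set `s = Ω₀`; `finiteDimensional_suppSub`), `trForm τ s` (the real
  bilinear pairing `Σ_{x ∈ s} Re τ(f(x)* g(x))` on all functions; `trForm_apply`), `formE τ s` (its restriction to `suppSub s`); `formE_isSymm` (for a
  Hermitian `τ`: `τ(a*) = conj τ(a)`), `formE_apply_self_eq_zero` ∕ `restrict_formE_nondegenerate` (for a FAITHFUL `τ`: `Re τ(a*a) > 0`, `a ≠ 0` —
  positive-definiteness, hence nondegeneracy on every subspace).
* §2 `gaugeNull L m s Λs U₀` = `N_𝔤(Q′(U₀))` (Hermitian-valued `λ` supported in `s` with `Q′_j(U₀)λ = 0` on `Λs j`, `j ≤ m`; `Q′_j(U₀) = QprimeIter (zdBlocking d L)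
  (bgT L U₀) j`), `rangeGen` ∕ `rangeSub` (= `Δ^η_{U₀}N_𝔤(Q′(U₀))` read in `suppSub s`, as the span of `𝟙_sΔ^η_{U₀}λ`, `λ ∈ N_𝔤`); ★ `projE τ s L m η Λs U₀`
  = THE ORTHOGONAL PROJECTION onto `rangeSub` along its `formE`-orthogonal complement ((3.21)–(3.22); `projE_eq_projection` under the `τ`-hypotheses via
  Mathlib's `isCompl_orthogonal_of_restrict_nondegenerate`; `projE_apply_of_mem_orthogonal` = 0, `projE_apply_of_mem_range` = id, `projE_apply_mem_range`,
  `projE_isIdempotentElem` (`R² = R`), `formE_projE_symm` (`⟨Rf, g⟩ = ⟨f, Rg⟩` — an ORTHOGONAL projection)), `projR` (the same on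
  functions `ℤᵈ → 𝔸`: restrict to `s`, project, read back).
* §3 `star_conjR_of_mem_unitaryUnits`, `star_covDerivFwd`, `star_covDeriv`, ★ `star_covLap` (for UNITARY `U₀`, `(Δ^η_{U₀}g)* = Δ^η_{U₀}(g*)` pointwise —
  so `Δ^η_{U₀}λ` is Hermitian for Hermitian `λ`).
* §4 ★★ `indicator_covDivB_mem_orthogonal` (U₀ unitary, `τ` tracial: `IsLandau138 L m η ↑s Λs U₀ A` ⇒ `𝟙_sD^{η*}_{U₀}A ∈ (rangeSub)^⊥` — the companion
  file's `Σᶠ τ((Δλ)(x)(𝟙D*A)(x)) = 0` read through `(Δλ)* = Δλ`); ★★ `projR_covDivB_eq_zero_of_isLandau138` («R(U₀)D^{η*}_{U₀}A = 0» AS AN EQUATION for the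
  constructed `R(U₀)`).
* §5 `opsLandau τ ops₀` (the letter family with `DRDs U₀ A := D^η_{U₀} R(U₀)(𝟙_{Ω₀}D^{η*}_{U₀}A)` at members with finite `Ω₀`, `ops₀`'s letter elsewhere);
  ★★★ `landauAt_opsLandau` — `B9SupplySockB9P3ZdAt.LandauAt bg L mem ιCfg (opsLandau τ ops₀) c35 a₃ M i m` for EVERY frame `bg ∕ mem ∕ ιCfg`, all
  `c35 a₃ M`, every member with `(i.Ω 0).Finite` (`L ≥ 1`, `𝔸` finite-dimensional with a faithful Hermitian trace `τ`) — the binder's class-(3.35) and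
  smallness hypotheses are NOT used: the Landau condition kills `D R(U₀) D* A` at every unitary background outright; A6: `landauAt_opsLandau_complex`
  (the abelian fibre `𝔸 = ℂ`, `τ = id`: every hypothesis discharged).

HONEST SCOPE.  (i) ONE letter of the record (`DRDs`) is made an OBJECT and ONE binder (`LandauAt`) is PROVED for it; `Gop ∕ Dp ∕ QQ` stay the consumer's
letters (`ops₀`), and `InvAt ∕ CurvAt ∕ AvgAt ∕ HolderAt` are untouched — N06's object layer ([4] (3.10), (3.16), (3.27), Thm 3.11, Thm 3.3) is NOT
claimed.  (ii) READING: print's `R(U)` acts on `L²(Ω₀, 𝔤)`; here it is the orthogonal projection of `𝔸`-valued functions on `Ω₀` onto the `𝔤`-VALUED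
subspace `Δ^η_{U₀}N_𝔤(Q′(U₀))` (`𝔤` = the Hermitian part — Bałaban's `U = e^{iηA}`, `A` Hermitian), for the pairing `Re τ(a*b)`; on `𝔤`-valued arguments
and unitary `U₀` this is (3.21)–(3.22) verbatim (the positive weight `η^d` of p. 393 does not change the projection); the span of the generating set IS
the subspace (the set is print's linear space — no linearity lemma for `Δ^η_{U₀} ∕ Q′_j` is needed or claimed).  (iii) `τ` is a PARAMETER with three
displayed properties (tracial, Hermitian, faithful) — print's normalised trace on `M_N(ℂ)` has them; no instance is declared.  (iv) At members with
infinite `Ω₀` the letter is `ops₀`'s (no claim); print's `Ω₀ ⊂ T_η` is finite.  (v) Count-neutral; N05 ∕ N06 NOT discharged; K1⁷ `stmt-QuantumFields-20542`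
NOT closed; one finite `𝕋⁴` programme at fixed `ε`, Bałaban as printed; R4 closes only the conditional finite-`𝕋⁴` rung `BalabanLadder.UV` — nothing
continuum ∕ ℝ⁴ ∕ OS ∕ mass gap ∕ Clay.  Unit `pub-ymgap-dag-n06-w4` (g0), 2026-08-27.
-/

noncomputable section

namespace Literature.MathematicalPhysics.QuantumFieldTheory.Balaban1983to89.B9Eq321LandauProjectionZd

open B7Prop1Explicit B7Eq78Linearization
open B7Prop2Explicit (unitaryUnits)
open B8Ineq132 (covDeriv covDerivFwd)
open B8Eq119TwistedAxial (bgT)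
open B8Eq138LandauZd (covDivB covLap QT IsLandau138)
open B8LeafModelZd (ZdIdx)
open B9SupplySockB9P3ZdLetters (OpsZd)
open B9SupplySockB9P3ZdLettersOmega (OnDom)
open B9SupplySockB9P3ZdAt (LandauAt)
open B9Eq321LandauOrthogonalZd (finsum_trace_covLap_mul_covDivB_eq_zero_of_isLandau138)

-- `Site` alone could resolve to the torus sites of `Setup.lean`; re-export the `ℤ^d` sites of `B7Prop1Explicit`.
export B7Prop1Explicit (Site)

variable {d : ℕ} {𝔸 : Type*} [CStarAlgebra 𝔸]

/-! ## §1  The real pairing space `L²(Ω₀, ·)`: functions supported in the finite `Ω₀ = s`, the pairing `Σ Re τ(f* g)` -/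

section Space

variable (τ : 𝔸 →ₗ[ℂ] ℂ) (s : Finset (Site d))

/-- **THE CARRIER OF `L²(Ω₀, ·)`**: the real subspace of functions `ℤᵈ → 𝔸` vanishing off the finite set `s = Ω₀` (Dirichlet reading of p. 394: all
operators «depend on the configuration U restricted to Ω₀»). [cite: Balaban1985BackgroundPropagators, (3.21) p.394 («the Hilbert space L²(Ω₀, 𝔤)»)] -/
def suppSub : Submodule ℝ (Site d → 𝔸) where
  carrier := {f | ∀ x, x ∉ s → f x = 0}
  add_mem' := by
    intro f g hf hg x hx
    rw [Pi.add_apply, hf x hx, hg x hx, add_zero]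
  zero_mem' := fun _ _ => rfl
  smul_mem' := by
    intro c f hf x hx
    rw [Pi.smul_apply, hf x hx, smul_zero]

/-- membership in `suppSub s`, unfolded. [cite: Balaban1985BackgroundPropagators, (3.21) p.394 (bookkeeping)] -/
theorem mem_suppSub_iff (f : Site d → 𝔸) : f ∈ suppSub (𝔸 := 𝔸) s ↔ ∀ x, x ∉ s → f x = 0 := Iff.rfl

/-- the indicator of `s` times any function lies in `suppSub s`. [cite: Balaban1985BackgroundPropagators, (3.24) p.394 («↾Ω₀», bookkeeping)] -/
theorem indicator_mem_suppSub (f : Site d → 𝔸) : (↑s : Set (Site d)).indicator f ∈ suppSub (𝔸 := 𝔸) s :=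
  fun _ hx => Set.indicator_of_notMem (fun h => hx (Finset.mem_coe.1 h)) _

/-- **`suppSub s` IS FINITE-DIMENSIONAL** over `ℝ` when the fibre is (restriction to `s` is injective). [folklore] -/
private theorem finiteDimensional_suppSub [FiniteDimensional ℝ 𝔸] : FiniteDimensional ℝ (suppSub (𝔸 := 𝔸) s) := by
  let res : (suppSub (𝔸 := 𝔸) s) →ₗ[ℝ] ((↥s) → 𝔸) :=
    { toFun := fun f x => (f : Site d → 𝔸) x
      map_add' := fun f g => rfl
      map_smul' := fun c f => rfl }
  refine FiniteDimensional.of_injective res fun f g h => ?_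
  apply Subtype.ext
  funext x
  by_cases hx : x ∈ s
  · exact congr_fun h ⟨x, hx⟩
  · rw [f.2 x hx, g.2 x hx]

/-- **THE PAIRING `Σ_{x ∈ Ω₀} Re τ(f(x)* g(x))`** on all functions `ℤᵈ → 𝔸` (print's «⟨λ, λ′⟩ = Σ_{x∈Ω₀} η^d tr λ(x)λ′(x)», p. 393, on `𝔤`-valued functions, the
positive weight `η^d` dropped; `Re τ(a* b)` agrees with `τ(ab)` on Hermitian `a, b` for a Hermitian trace), as a real bilinear form.
[cite: Balaban1985BackgroundPropagators, (3.17) p.393 (the scalar product), p.391 («X·Y = tr XY»)] -/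
def trForm : LinearMap.BilinForm ℝ (Site d → 𝔸) :=
  LinearMap.mk₂ ℝ (fun f g => ∑ x ∈ s, (τ (star (f x) * g x)).re)
    (fun f₁ f₂ g => by
      rw [← Finset.sum_add_distrib]
      refine Finset.sum_congr rfl fun x _ => ?_
      rw [Pi.add_apply, star_add, add_mul, map_add, Complex.add_re])
    (fun c f g => by
      rw [Finset.smul_sum]
      refine Finset.sum_congr rfl fun x _ => ?_
      rw [Pi.smul_apply, star_smul, star_trivial, smul_mul_assoc, ← Complex.coe_smul, map_smul, smul_eq_mul, smul_eq_mul,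
        Complex.re_ofReal_mul])
    (fun f g₁ g₂ => by
      rw [← Finset.sum_add_distrib]
      refine Finset.sum_congr rfl fun x _ => ?_
      rw [Pi.add_apply, mul_add, map_add, Complex.add_re])
    (fun c f g => by
      rw [Finset.smul_sum]
      refine Finset.sum_congr rfl fun x _ => ?_
      rw [Pi.smul_apply, mul_smul_comm, ← Complex.coe_smul, map_smul, smul_eq_mul, smul_eq_mul, Complex.re_ofReal_mul])

/-- the pairing, unfolded. [cite: Balaban1985BackgroundPropagators, (3.17) p.393 (bookkeeping)] -/
theorem trForm_apply (f g : Site d → 𝔸) : trForm τ s f g = ∑ x ∈ s, (τ (star (f x) * g x)).re := rfl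

/-- **THE PAIRING ON `L²(Ω₀, ·)`**: `trForm` restricted to `suppSub s`. [cite: Balaban1985BackgroundPropagators, (3.21) p.394 («the Hilbert space L²(Ω₀, 𝔤)»)] -/
def formE : LinearMap.BilinForm ℝ (suppSub (𝔸 := 𝔸) s) := (trForm τ s).restrict (suppSub s)

/-- the restricted pairing, unfolded. [cite: Balaban1985BackgroundPropagators, (3.21) p.394 (bookkeeping)] -/
theorem formE_apply (f g : suppSub (𝔸 := 𝔸) s) :
    formE τ s f g = ∑ x ∈ s, (τ (star ((f : Site d → 𝔸) x) * (g : Site d → 𝔸) x)).re := rfl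

/-- **SYMMETRY** for a Hermitian trace (`τ(a*) = conj τ(a)`): `Re τ(f* g) = Re τ(g* f)`. [cite: Balaban1985BackgroundPropagators, p.391 (the scalar product is symmetric)] -/
theorem formE_isSymm (hτs : ∀ a : 𝔸, τ (star a) = starRingEnd ℂ (τ a)) : (formE τ s).IsSymm := by
  refine ⟨fun f g => ?_⟩
  rw [formE_apply, formE_apply]
  refine Finset.sum_congr rfl fun x _ => ?_
  have h : star ((g : Site d → 𝔸) x) * (f : Site d → 𝔸) x = star (star ((f : Site d → 𝔸) x) * (g : Site d → 𝔸) x) := by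
    rw [star_mul, star_star]
  rw [h, hτs, Complex.conj_re]

/-- each diagonal term `Re τ(a* a)` is non-negative for a faithful positive trace. [folklore] -/
private theorem re_trace_star_mul_self_nonneg (hτp : ∀ a : 𝔸, a ≠ 0 → 0 < (τ (star a * a)).re) (a : 𝔸) : 0 ≤ (τ (star a * a)).re := by
  by_cases ha : a = 0
  · rw [ha, mul_zero, map_zero, Complex.zero_re]
  · exact (hτp a ha).le

/-- **POSITIVE-DEFINITENESS** for a faithful positive trace (`Re τ(a*a) > 0` for `a ≠ 0`): `⟨f, f⟩ = 0` only for `f = 0` on `L²(Ω₀, ·)`.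
[cite: Balaban1985BackgroundPropagators, (3.21) p.394 («the Hilbert space L²(Ω₀, 𝔤)»)] -/
theorem formE_apply_self_eq_zero (hτp : ∀ a : 𝔸, a ≠ 0 → 0 < (τ (star a * a)).re) {f : suppSub (𝔸 := 𝔸) s}
    (h : formE τ s f f = 0) : f = 0 := by
  rw [formE_apply] at h
  have hx : ∀ x ∈ s, (τ (star ((f : Site d → 𝔸) x) * (f : Site d → 𝔸) x)).re = 0 :=
    (Finset.sum_eq_zero_iff_of_nonneg fun x _ => re_trace_star_mul_self_nonneg τ hτp _).1 h
  apply Subtype.ext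
  funext x
  by_cases hxs : x ∈ s
  · by_contra hne
    exact (hτp _ hne).ne' (hx x hxs)
  · exact f.2 x hxs

/-- **NONDEGENERACY ON EVERY SUBSPACE** of `L²(Ω₀, ·)` (positive-definite forms restrict to nondegenerate ones). [cite: Balaban1985BackgroundPropagators, (3.21) p.394 («the Hilbert space L²(Ω₀, 𝔤)»)] -/
theorem restrict_formE_nondegenerate (hτp : ∀ a : 𝔸, a ≠ 0 → 0 < (τ (star a * a)).re) (W : Submodule ℝ (suppSub (𝔸 := 𝔸) s)) :
    ((formE τ s).restrict W).Nondegenerate := by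
  refine ⟨fun w hw => ?_, fun w hw => ?_⟩
  · have h := hw w
    rw [LinearMap.BilinForm.restrict_apply, LinearMap.domRestrict_apply] at h
    exact Subtype.ext (formE_apply_self_eq_zero τ s hτp h)
  · have h := hw w
    rw [LinearMap.BilinForm.restrict_apply, LinearMap.domRestrict_apply] at h
    exact Subtype.ext (formE_apply_self_eq_zero τ s hτp h)

end Space

/-! ## §2  `N_𝔤(Q′(U₀))`, `Δ^η_{U₀}N_𝔤(Q′(U₀))`, and the orthogonal projection `R(U₀)` of (3.21)–(3.22) -/

section Projection

variable (τ : 𝔸 →ₗ[ℂ] ℂ) (s : Finset (Site d)) (L m : ℕ) (η : ℝ) (Λs : ℕ → Set (Site d)) (U₀ : Site d → Fin d → 𝔸ˣ)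

/-- **`N_𝔤(Q′(U₀))`** («N(Q′) = {λ : Q′λ = 0}», (3.21), in `L²(Ω₀, 𝔤)`): Hermitian-valued gauge functions supported in `s = Ω₀` with
`(Q′_j(U₀)λ)(y) = 0` for `y ∈ Λs j`, `j ≤ m` (`Q′_j(U₀) = QprimeIter (zdBlocking d L) (bgT L U₀) j`, (3.19); `j = 0` reads `λ = 0` on `Λ₀`).
[cite: Balaban1985BackgroundPropagators, (3.21) p.394, (3.18)–(3.19) p.393] -/
def gaugeNull : Set (Site d → 𝔸) :=
  {lam | (∀ x, IsSelfAdjoint (lam x)) ∧ (∀ x, x ∉ s → lam x = 0) ∧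
    ∀ j, j ≤ m → ∀ y ∈ Λs j, QprimeIter (zdBlocking d L) (bgT L U₀) j lam y = 0}

/-- **THE GENERATORS OF `R = Δ^η_{U₀}N(Q′)`** read in `L²(Ω₀, ·)`: the functions `𝟙_{Ω₀}·Δ^η_{U₀}λ`, `λ ∈ N_𝔤(Q′(U₀))` (Dirichlet reading «↾Ω₀»).
[cite: Balaban1985BackgroundPropagators, (3.21) p.394, (3.23)–(3.24) p.394] -/
def rangeGen : Set (suppSub (𝔸 := 𝔸) s) :=
  {w | ∃ lam ∈ gaugeNull s L m Λs U₀, (w : Site d → 𝔸) = (↑s : Set (Site d)).indicator (covLap η U₀ lam)}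

/-- **`R = Δ^η_{U₀}N_𝔤(Q′(U₀))`** as a real subspace of `L²(Ω₀, ·)` (the span of the generators — the generating set is print's linear space itself).
[cite: Balaban1985BackgroundPropagators, (3.21) p.394] -/
def rangeSub : Submodule ℝ (suppSub (𝔸 := 𝔸) s) := Submodule.span ℝ (rangeGen s L m η Λs U₀)

open Classical in
/-- ★ **`R(U₀)`, THE ORTHOGONAL PROJECTION ONTO `Δ^η_{U₀}N(Q′(U₀))`** ((3.21)–(3.22)) in `L²(Ω₀, ·)` for the pairing `formE τ s`: the projection onto
`rangeSub` along its `formE`-orthogonal complement (defined whenever the two are complementary — always, for a faithful Hermitian `τ` and a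
finite-dimensional fibre: `projE_eq_projection`; `0` otherwise). [cite: Balaban1985BackgroundPropagators, (3.21)–(3.22) p.394] -/
def projE : suppSub (𝔸 := 𝔸) s →ₗ[ℝ] suppSub (𝔸 := 𝔸) s :=
  if h : IsCompl (rangeSub s L m η Λs U₀) ((formE τ s).orthogonal (rangeSub s L m η Λs U₀)) then
    (rangeSub s L m η Λs U₀).projection ((formE τ s).orthogonal (rangeSub s L m η Λs U₀)) h
  else 0

/-- **`R(U₀)` ON FUNCTIONS `ℤᵈ → 𝔸`**: restrict to `Ω₀` (Dirichlet), project, read back as a function. [cite: Balaban1985BackgroundPropagators, (3.21)–(3.22) p.394, (3.24) p.394 («↾Ω₀»)] -/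
def projR (f : Site d → 𝔸) : Site d → 𝔸 :=
  ((projE τ s L m η Λs U₀ ⟨(↑s : Set (Site d)).indicator f, indicator_mem_suppSub s f⟩ : suppSub (𝔸 := 𝔸) s) : Site d → 𝔸)

variable {τ s}

/-- **THE COMPLEMENT EXISTS** for a faithful Hermitian trace on a finite-dimensional fibre: `L²(Ω₀, ·) = R ⊕ R^⊥` (Mathlib:
`isCompl_orthogonal_of_restrict_nondegenerate`). [cite: Balaban1985BackgroundPropagators, (3.21)–(3.22) p.394] -/
theorem isCompl_rangeSub_orthogonal [FiniteDimensional ℝ 𝔸] (hτs : ∀ a : 𝔸, τ (star a) = starRingEnd ℂ (τ a))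
    (hτp : ∀ a : 𝔸, a ≠ 0 → 0 < (τ (star a * a)).re) :
    IsCompl (rangeSub s L m η Λs U₀) ((formE τ s).orthogonal (rangeSub s L m η Λs U₀)) := by
  haveI := finiteDimensional_suppSub (𝔸 := 𝔸) s
  exact LinearMap.BilinForm.isCompl_orthogonal_of_restrict_nondegenerate (formE_isSymm τ s hτs).isRefl
    (restrict_formE_nondegenerate τ s hτp _)

/-- `R(U₀)` IS the projection onto `R` along `R^⊥` under the `τ`-hypotheses. [cite: Balaban1985BackgroundPropagators, (3.21)–(3.22) p.394] -/
theorem projE_eq_projection [FiniteDimensional ℝ 𝔸] (hτs : ∀ a : 𝔸, τ (star a) = starRingEnd ℂ (τ a))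
    (hτp : ∀ a : 𝔸, a ≠ 0 → 0 < (τ (star a * a)).re) :
    projE τ s L m η Λs U₀ = (rangeSub s L m η Λs U₀).projection ((formE τ s).orthogonal (rangeSub s L m η Λs U₀))
      (isCompl_rangeSub_orthogonal L m η Λs U₀ hτs hτp) := by
  rw [projE, dif_pos (isCompl_rangeSub_orthogonal L m η Λs U₀ hτs hτp)]

/-- **`R(U₀)f = 0` FOR `f ⊥ R`** ((3.22): the minimiser is `λ₀ = 0`). [cite: Balaban1985BackgroundPropagators, (3.22) p.394] -/
theorem projE_apply_of_mem_orthogonal [FiniteDimensional ℝ 𝔸] (hτs : ∀ a : 𝔸, τ (star a) = starRingEnd ℂ (τ a))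
    (hτp : ∀ a : 𝔸, a ≠ 0 → 0 < (τ (star a * a)).re) {f : suppSub (𝔸 := 𝔸) s}
    (hf : f ∈ (formE τ s).orthogonal (rangeSub s L m η Λs U₀)) : projE τ s L m η Λs U₀ f = 0 := by
  rw [projE_eq_projection L m η Λs U₀ hτs hτp]
  exact Submodule.projection_apply_of_mem_right _ hf

/-- **`R(U₀)w = w` FOR `w ∈ R`** (a genuine projection: the letter is NOT the zero map whenever `Δ^η_{U₀}N_𝔤(Q′(U₀)) ≠ 0`).
[cite: Balaban1985BackgroundPropagators, (3.21)–(3.22) p.394] -/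
theorem projE_apply_of_mem_range [FiniteDimensional ℝ 𝔸] (hτs : ∀ a : 𝔸, τ (star a) = starRingEnd ℂ (τ a))
    (hτp : ∀ a : 𝔸, a ≠ 0 → 0 < (τ (star a * a)).re) {w : suppSub (𝔸 := 𝔸) s}
    (hw : w ∈ rangeSub s L m η Λs U₀) : projE τ s L m η Λs U₀ w = w := by
  rw [projE_eq_projection L m η Λs U₀ hτs hτp]
  exact Submodule.projection_apply_of_mem_left _ hw

/-- `R(U₀)f ∈ R` for every `f` (the projection lands in `Δ^η_{U₀}N(Q′(U₀))`). [cite: Balaban1985BackgroundPropagators, (3.22) p.394 («Rf = Δ^η_Uλ₀»)] -/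
theorem projE_apply_mem_range [FiniteDimensional ℝ 𝔸] (hτs : ∀ a : 𝔸, τ (star a) = starRingEnd ℂ (τ a))
    (hτp : ∀ a : 𝔸, a ≠ 0 → 0 < (τ (star a * a)).re) (f : suppSub (𝔸 := 𝔸) s) :
    projE τ s L m η Λs U₀ f ∈ rangeSub s L m η Λs U₀ := by
  rw [projE_eq_projection L m η Λs U₀ hτs hτp]
  exact Submodule.projection_apply_mem _ f

/-- **`R(U₀)` IS IDEMPOTENT** (`R² = R`). [cite: Balaban1985BackgroundPropagators, (3.21) p.394 («an orthogonal projection»)] -/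
theorem projE_isIdempotentElem [FiniteDimensional ℝ 𝔸] (hτs : ∀ a : 𝔸, τ (star a) = starRingEnd ℂ (τ a))
    (hτp : ∀ a : 𝔸, a ≠ 0 → 0 < (τ (star a * a)).re) : IsIdempotentElem (projE τ s L m η Λs U₀) := by
  rw [projE_eq_projection L m η Λs U₀ hτs hτp]
  exact Submodule.isIdempotentElem_projection _

/-- **`R(U₀)` IS SYMMETRIC for the pairing** (`⟨Rf, g⟩ = ⟨f, Rg⟩` — an ORTHOGONAL projection: `f − Rf ⊥ R`). [cite: Balaban1985BackgroundPropagators, (3.21) p.394 («an orthogonal projection»)] -/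
theorem formE_projE_symm [FiniteDimensional ℝ 𝔸] (hτs : ∀ a : 𝔸, τ (star a) = starRingEnd ℂ (τ a))
    (hτp : ∀ a : 𝔸, a ≠ 0 → 0 < (τ (star a * a)).re) (f g : suppSub (𝔸 := 𝔸) s) :
    formE τ s (projE τ s L m η Λs U₀ f) g = formE τ s f (projE τ s L m η Λs U₀ g) := by
  have hc := isCompl_rangeSub_orthogonal (s := s) (τ := τ) L m η Λs U₀ hτs hτp
  set W := rangeSub (𝔸 := 𝔸) s L m η Λs U₀ with hW
  set P := projE τ s L m η Λs U₀ with hP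
  have hPf : P f ∈ W := projE_apply_mem_range L m η Λs U₀ hτs hτp f
  have hPg : P g ∈ W := projE_apply_mem_range L m η Λs U₀ hτs hτp g
  -- `x − Rx ∈ R^⊥`
  have hres : ∀ x : suppSub (𝔸 := 𝔸) s, x - P x ∈ (formE τ s).orthogonal W := by
    intro x
    rw [hP, projE_eq_projection L m η Λs U₀ hτs hτp]
    exact Submodule.sub_projection_mem hc x
  have hsym := formE_isSymm τ s hτs
  have h1 : formE τ s (P f) g = formE τ s (P f) (P g) := by
    have h0 : formE τ s (P f) (g - P g) = 0 := (LinearMap.BilinForm.mem_orthogonal_iff.1 (hres g)) _ hPf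
    rw [map_sub] at h0
    exact (sub_eq_zero.1 h0)
  have h2 : formE τ s f (P g) = formE τ s (P f) (P g) := by
    have h0 : formE τ s (P g) (f - P f) = 0 := (LinearMap.BilinForm.mem_orthogonal_iff.1 (hres f)) _ hPg
    rw [map_sub] at h0
    have h0' : formE τ s (P g) f = formE τ s (P g) (P f) := sub_eq_zero.1 h0
    rw [hsym.eq f (P g), h0', hsym.eq (P g) (P f)]
  rw [h1, h2]

end Projection

/-! ## §3  `Δ^η_{U₀}` commutes with the adjoint at a UNITARY background -/

section Star

variable (η : ℝ) {U₀ : Site d → Fin d → 𝔸ˣ}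

omit [CStarAlgebra 𝔸] in
/-- `(R(u)a)* = R(u)(a*)` for a UNITARY `u` (`u* = u⁻¹`). [cite: Balaban1985RegularSpaces, (1.1) p.76 (the transporters R(U(b)) are unitary)] -/
theorem star_conjR_of_mem_unitaryUnits {𝔸 : Type*} [NormedRing 𝔸] [StarRing 𝔸] [NormedAlgebra ℂ 𝔸] {u : 𝔸ˣ} (hu : u ∈ unitaryUnits 𝔸) (a : 𝔸) :
    star (conjR u a) = conjR u (star a) := by
  have hu' : (u : 𝔸) ∈ unitary 𝔸 := hu
  have hinv : ((u⁻¹ : 𝔸ˣ) : 𝔸) = star (u : 𝔸) :=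
    Units.inv_eq_of_mul_eq_one_right (Unitary.mul_star_self_of_mem hu')
  rw [conjR_apply, conjR_apply, hinv, star_mul, star_mul, star_star, mul_assoc]

/-- `(D^η_{U₀,μ}F)* = D^η_{U₀,μ}(F*)` pointwise, for unitary `U₀`. [cite: Balaban1985RegularSpaces, (1.1) p.76] -/
theorem star_covDerivFwd (hU : ∀ (x : Site d) (κ : Fin d), U₀ x κ ∈ unitaryUnits 𝔸) (μ : Fin d) (F : Site d → 𝔸) (x : Site d) :
    star (covDerivFwd η U₀ μ F x) = covDerivFwd η U₀ μ (fun z => star (F z)) x := by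
  simp only [covDerivFwd, star_smul, star_trivial, star_sub, star_conjR_of_mem_unitaryUnits (hU x μ)]

/-- `(D^{η*}_{U₀,ν}F)* = D^{η*}_{U₀,ν}(F*)` pointwise, for unitary `U₀`. [cite: Balaban1985RegularSpaces, (1.1) p.76] -/
theorem star_covDeriv (hU : ∀ (x : Site d) (κ : Fin d), U₀ x κ ∈ unitaryUnits 𝔸) (ν : Fin d) (F : Site d → 𝔸) (x : Site d) :
    star (covDeriv η U₀ ν F x) = covDeriv η U₀ ν (fun z => star (F z)) x := by
  simp only [covDeriv, star_smul, star_trivial, star_sub,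
    star_conjR_of_mem_unitaryUnits ((unitaryUnits 𝔸).inv_mem (hU (x - e ν) ν))]

/-- ★ **`(Δ^η_{U₀}g)* = Δ^η_{U₀}(g*)` POINTWISE FOR A UNITARY BACKGROUND** ((3.23) `Δ^η_U = D^{η*}_U D^η_U` with unitary transporters): in particular
`Δ^η_{U₀}λ` is Hermitian-valued for Hermitian-valued `λ` — `R = Δ^η_UN(Q′) ⊂ L²(Ω₀, 𝔤)`. [cite: Balaban1985BackgroundPropagators, (3.23) p.394, (3.21) p.394] -/
theorem star_covLap (hU : ∀ (x : Site d) (κ : Fin d), U₀ x κ ∈ unitaryUnits 𝔸) (g : Site d → 𝔸) (x : Site d) :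
    star (covLap η U₀ g x) = covLap η U₀ (fun z => star (g z)) x := by
  simp only [covLap, covDivB, star_sum, star_covDeriv η hU]
  refine Finset.sum_congr rfl fun μ _ => ?_
  congr 1
  funext z
  exact star_covDerivFwd η hU μ g z

/-- `Δ^η_{U₀}λ` is Hermitian-valued for Hermitian-valued `λ` and unitary `U₀`. [cite: Balaban1985BackgroundPropagators, (3.21), (3.23) p.394] -/
theorem star_covLap_of_isSelfAdjoint (hU : ∀ (x : Site d) (κ : Fin d), U₀ x κ ∈ unitaryUnits 𝔸) {lam : Site d → 𝔸}
    (hlam : ∀ x, IsSelfAdjoint (lam x)) (x : Site d) : star (covLap η U₀ lam x) = covLap η U₀ lam x := by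
  rw [star_covLap η hU]
  congr 1
  funext z
  exact (hlam z).star_eq

end Star

/-! ## §4  The Landau condition of record puts `D^{η*}_{U₀}A` in `R(U₀)^⊥`: `R(U₀)D^{η*}_{U₀}A = 0` as an equation -/

section Kill

variable {τ : 𝔸 →ₗ[ℂ] ℂ} {s : Finset (Site d)} {L m : ℕ} [NeZero L] {η : ℝ} {Λs : ℕ → Set (Site d)} {U₀ : Site d → Fin d → 𝔸ˣ}

/-- ★★ **`𝟙_{Ω₀}D^{η*}_{U₀}A ∈ R(U₀)^⊥` UNDER THE LANDAU CONDITION OF RECORD**: for a tracial `τ` (`τ(ab) = τ(ba)`), a unitary `U₀` and `A` with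
`IsLandau138 L m η Ω₀ Λs U₀ A` (`Ω₀ = s`), every generator `𝟙_{Ω₀}Δ^η_{U₀}λ`, `λ ∈ N_𝔤(Q′(U₀))`, is `formE`-orthogonal to `𝟙_{Ω₀}D^{η*}_{U₀}A`: by
`(Δ^η_{U₀}λ)* = Δ^η_{U₀}λ` (§3) the pairing is `Re Σ_x τ((Δ^η_{U₀}λ)(x)·(𝟙_{Ω₀}D^{η*}_{U₀}A)(x)) = Re 0` (companion file, tracial pairing, all units).
[cite: Balaban1985RegularSpaces, (1.38) p.82; Balaban1985BackgroundPropagators, (3.20)–(3.21) p.394] -/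
theorem indicator_covDivB_mem_orthogonal (hτt : ∀ a b : 𝔸, τ (a * b) = τ (b * a))
    (hU : ∀ (x : Site d) (κ : Fin d), U₀ x κ ∈ unitaryUnits 𝔸) {A : Site d → Fin d → 𝔸}
    (h : IsLandau138 L m η (↑s : Set (Site d)) Λs U₀ A) :
    (⟨(↑s : Set (Site d)).indicator (covDivB η U₀ A), indicator_mem_suppSub s _⟩ : suppSub (𝔸 := 𝔸) s) ∈
      (formE τ s).orthogonal (rangeSub s L m η Λs U₀) := by
  rw [LinearMap.BilinForm.mem_orthogonal_iff]
  intro w hw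
  -- reduce to the generators: `{w | formE w f = 0}` is a subspace
  induction hw using Submodule.span_induction with
  | mem w hw =>
    obtain ⟨lam, ⟨hsa, hsupp, hQ⟩, hwlam⟩ := hw
    rw [formE_apply, hwlam]
    have key := finsum_trace_covLap_mul_covDivB_eq_zero_of_isLandau138 (L := L) τ hτt s.finite_toSet h
      (fun x hx => hsupp x fun hx' => hx (Finset.mem_coe.2 hx')) hQ
    have hsup : (Function.support fun x => τ (covLap η U₀ lam x * (↑s : Set (Site d)).indicator (covDivB η U₀ A) x)) ⊆ ↑s := by
      intro x hx
      rw [Function.mem_support] at hx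
      by_contra hxs
      exact hx (by rw [Set.indicator_of_notMem hxs, mul_zero, map_zero])
    rw [finsum_eq_sum_of_support_subset _ hsup] at key
    have hre := congrArg Complex.re key
    rw [Complex.re_sum, Complex.zero_re] at hre
    rw [← hre]
    refine Finset.sum_congr rfl fun x hx => ?_
    have hxs : x ∈ (↑s : Set (Site d)) := Finset.mem_coe.2 hx
    rw [Set.indicator_of_mem hxs, star_covLap_of_isSelfAdjoint η hU hsa]
  | zero => rw [map_zero, LinearMap.zero_apply]
  | add w₁ w₂ _ _ h₁ h₂ => rw [map_add, LinearMap.add_apply, h₁, h₂, add_zero]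
  | smul c w _ hw => rw [map_smul, LinearMap.smul_apply, hw, smul_zero]

/-- ★★ **«R(U₀)D^{η*}_{U₀}A = 0» AS AN EQUATION FOR THE CONSTRUCTED `R(U₀)`**: `τ` a faithful Hermitian trace on a finite-dimensional fibre, `U₀` unitary,
`IsLandau138 L m η Ω₀ Λs U₀ A` ⟹ `projR … U₀ (D^{η*}_{U₀}A) = 0`. [cite: Balaban1985RegularSpaces, (1.38) p.82, (1.42) p.83; Balaban1985BackgroundPropagators, (3.20)–(3.22) p.394] -/
theorem projR_covDivB_eq_zero_of_isLandau138 [FiniteDimensional ℝ 𝔸] (hτt : ∀ a b : 𝔸, τ (a * b) = τ (b * a))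
    (hτs : ∀ a : 𝔸, τ (star a) = starRingEnd ℂ (τ a)) (hτp : ∀ a : 𝔸, a ≠ 0 → 0 < (τ (star a * a)).re)
    (hU : ∀ (x : Site d) (κ : Fin d), U₀ x κ ∈ unitaryUnits 𝔸) {A : Site d → Fin d → 𝔸}
    (h : IsLandau138 L m η (↑s : Set (Site d)) Λs U₀ A) :
    projR τ s L m η Λs U₀ (covDivB η U₀ A) = 0 := by
  rw [projR, projE_apply_of_mem_orthogonal L m η Λs U₀ hτs hτp (indicator_covDivB_mem_orthogonal hτt hU h)]
  rfl

end Kill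

/-! ## §5  The letter family `opsLandau` (`DRDs := D^η_{U₀} R(U₀) 𝟙_{Ω₀}D^{η*}_{U₀}`) and the binder `LandauAt` PROVED for it -/

section Letter

variable (τ : 𝔸 →ₗ[ℂ] ℂ) {L : ℕ}

open Classical in
/-- **THE LETTER FAMILY WITH A GENUINE `DRD*`**: `ops₀` with its `DRDs` field replaced, at every member `(M, i, m)` whose `Ω₀ = i.Ω 0` is finite, by
`(DRDs U₀ A)(⟨x, x + e_μ⟩) := (D^η_{U₀,μ} R(U₀)(𝟙_{Ω₀}D^{η*}_{U₀}A))(x)` with `R(U₀) = projR τ Ω₀ L m i.η (i.Λs m) U₀` the orthogonal projection of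
(3.21)–(3.22); at members with infinite `Ω₀` the letter is `ops₀`'s (no claim).  `Gop ∕ Dp ∕ QQ` are `ops₀`'s letters.
[cite: Balaban1985BackgroundPropagators, (3.26) p.395 («D^η_U R(U) D^{η*}_U»), (3.20)–(3.22) p.394] -/
def opsLandau (ops₀ : ℝ → ZdIdx d L → ℕ → OpsZd d 𝔸) (M : ℝ) (i : ZdIdx d L) (m : ℕ) : OpsZd d 𝔸 where
  Gop := (ops₀ M i m).Gop
  Dp := (ops₀ M i m).Dp
  QQ := (ops₀ M i m).QQ
  DRDs := fun U₀ A x μ =>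
    if h : (i.Ω 0).Finite then covDerivFwd i.η U₀ μ (projR τ h.toFinset L m i.η (i.Λs m) U₀ (covDivB i.η U₀ A)) x
    else (ops₀ M i m).DRDs U₀ A x μ

/-- the letter at a member with finite `Ω₀`, unfolded. [cite: Balaban1985BackgroundPropagators, (3.26) p.395 (bookkeeping)] -/
theorem opsLandau_DRDs_of_finite (ops₀ : ℝ → ZdIdx d L → ℕ → OpsZd d 𝔸) (M : ℝ) (i : ZdIdx d L) (m : ℕ) (hΩ : (i.Ω 0).Finite)
    (U₀ : Site d → Fin d → 𝔸ˣ) (A : Site d → Fin d → 𝔸) (x : Site d) (μ : Fin d) :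
    (opsLandau τ ops₀ M i m).DRDs U₀ A x μ =
      covDerivFwd i.η U₀ μ (projR τ hΩ.toFinset L m i.η (i.Λs m) U₀ (covDivB i.η U₀ A)) x := by
  simp only [opsLandau, dif_pos hΩ]

/-- ★★★ **THE JUNCTION BINDER `LandauAt` HOLDS FOR THE GENUINE LETTER** — [Balaban1985RegularSpaces] (1.42)∕(1.58) «for `A` in the Landau gauge the
equation has no `DRD*` term», [Balaban1985BackgroundPropagators] (3.20)–(3.21): for `𝔸` finite-dimensional with a faithful Hermitian trace `τ`, EVERY
frame `bg ∕ mem ∕ ιCfg`, all `c35 a₃ M`, and every member `(M, i, m)` with `(i.Ω 0).Finite`,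
`B9SupplySockB9P3ZdAt.LandauAt bg L mem ιCfg (opsLandau τ ops₀) c35 a₃ M i m` — i.e. for every unitary `U₀` (the class-(3.35) and smallness hypotheses
of the binder are not used), every `A ∈ E(Ω₀)` with `IsLandau138 L m i.η (i.Ω 0) (i.Λs m) U₀ A`: `D^η_{U₀} R(U₀) 𝟙_{Ω₀}D^{η*}_{U₀} A = 0`.
[cite: Balaban1985RegularSpaces, (1.42) p.83, (1.58) p.86, (1.38) p.82; Balaban1985BackgroundPropagators, (3.20)–(3.22) p.394, (3.26) p.395] -/
theorem landauAt_opsLandau [NeZero L] [FiniteDimensional ℝ 𝔸] (hτt : ∀ a b : 𝔸, τ (a * b) = τ (b * a))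
    (hτs : ∀ a : 𝔸, τ (star a) = starRingEnd ℂ (τ a)) (hτp : ∀ a : 𝔸, a ≠ 0 → 0 < (τ (star a * a)).re)
    (ops₀ : ℝ → ZdIdx d L → ℕ → OpsZd d 𝔸)
    {I : Type} (bg : I → B9.Backgrounds) (mem : ℝ → ZdIdx d L → ℕ → I)
    (ιCfg : ∀ (M : ℝ) (i : ZdIdx d L) (m : ℕ) (U₀ : Site d → Fin d → 𝔸ˣ), (∀ x κ, U₀ x κ ∈ unitaryUnits 𝔸) → (bg (mem M i m)).Cfg)
    (c35 a₃ M : ℝ) (i : ZdIdx d L) (m : ℕ) (hΩ : (i.Ω 0).Finite) :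
    LandauAt bg L mem ιCfg (opsLandau τ ops₀) c35 a₃ M i m := by
  intro α₀ U₀ hU₀ _ _ _ A _ hL x μ
  rw [opsLandau_DRDs_of_finite τ ops₀ M i m hΩ]
  have hs : (↑hΩ.toFinset : Set (Site d)) = i.Ω 0 := hΩ.coe_toFinset
  have h' : IsLandau138 L m i.η (↑hΩ.toFinset : Set (Site d)) (i.Λs m) U₀ A := by rw [hs]; exact hL
  rw [projR_covDivB_eq_zero_of_isLandau138 hτt hτs hτp hU₀ h']
  exact B8Eq138LandauZd.covDerivFwd_zero_fun i.η U₀ μ x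

/-- **A6 ∕ NON-VACUITY OF THE `τ`-HYPOTHESES — THE ABELIAN FIBRE**: for `𝔸 = ℂ` (the `U(1)` case) with `τ = id` the three trace properties hold
(`ab = ba`, `star = conj`, `Re(ā a) = |a|² > 0`), so `LandauAt` holds for the genuine letter at every member with finite `Ω₀`, with NO hypothesis left.
(For `𝔸 = M_N(ℂ)` with the normalised trace the three properties are `Matrix.trace_mul_comm`, `Matrix.trace_conjTranspose` and Frobenius
positivity.) [cite: Balaban1985BackgroundPropagators, (3.20)–(3.22) p.394; Balaban1985RegularSpaces, (1.42) p.83] -/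
theorem landauAt_opsLandau_complex [NeZero L] (ops₀ : ℝ → ZdIdx d L → ℕ → OpsZd d ℂ)
    {I : Type} (bg : I → B9.Backgrounds) (mem : ℝ → ZdIdx d L → ℕ → I)
    (ιCfg : ∀ (M : ℝ) (i : ZdIdx d L) (m : ℕ) (U₀ : Site d → Fin d → ℂˣ), (∀ x κ, U₀ x κ ∈ unitaryUnits ℂ) → (bg (mem M i m)).Cfg)
    (c35 a₃ M : ℝ) (i : ZdIdx d L) (m : ℕ) (hΩ : (i.Ω 0).Finite) :
    LandauAt bg L mem ιCfg (opsLandau (LinearMap.id : ℂ →ₗ[ℂ] ℂ) ops₀) c35 a₃ M i m := by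
  refine landauAt_opsLandau (𝔸 := ℂ) LinearMap.id (fun a b => by rw [mul_comm]) (fun a => rfl) (fun a ha => ?_)
    ops₀ bg mem ιCfg c35 a₃ M i m hΩ
  rw [LinearMap.id_apply, Complex.star_def, ← Complex.normSq_eq_conj_mul_self, Complex.ofReal_re]
  exact Complex.normSq_pos.2 ha

end Letter

end Literature.MathematicalPhysics.QuantumFieldTheory.Balaban1983to89.B9Eq321LandauProjectionZd

end
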